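import Summits.HodgeConjecture.HodgeConjecture.Theorems.EndoscopicMiddleDegreeAlgebraicOrEnvelopedOfAlgebraicKernel
import Summits.HodgeConjecture.HodgeConjecture.Theorems.EndoscopicMiddleDegreeAlgebraicOrEnvelopedStubHeckeGraphAlgebraic
import Summits.HodgeConjecture.HodgeConjecture.Theorems.EndoscopicMiddleDegreeAlgebraicOrEnvelopedStubCorrActionAdjoint
import Summits.HodgeConjecture.HodgeConjecture.Theorems.EndoscopicMiddleDegreeOrthogonalEnvelopedOfCoreVanishing
import Literature.AlgebraicGeometry.HodgeTheory.HardLefschetzHodgeRiemannHolds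
import Literature.AlgebraicGeometry.HodgeTheory.MotivatedClassesProofs
import HarnessLib

/-!
# `AlgebraicOrEnveloped` from the Hodge conjecture on Hecke cores — the skeleton of line `core-splitting-ladder`, durably

Crux `EndoscopicMiddleDegree.AlgebraicOrEnveloped` (stmt-HodgeConjecture-14943, rank 5, THE DICHOTOMY: on a compact ball
quotient `X` of dimension `2n = 2(m+1)`, `m ∈ {1,2}`, with HC in degree `2m`, every rational Hodge `(n,n)`-class is algebraic
or enveloped by a rationality-preserving, `(n,n)`-valued action `P_γ` of an algebraic self-correspondence). This file is the
DURABLE FORM of the registered skeleton of line `core-splitting-ladder` (`Cruxes/AlgebraicOrEnveloped/Lines/core_splitting_ladder.lean`,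
lead seats a1/c3, rev 4 → rev 5) with its stubs turned into hypotheses — the crux is kernel-checked CLOSED MODULO exactly:
* `Grothendieck1969_supportedClasses_le_hodgeConiveau` — Literature named fact (Grothendieck 1969 p. 300; only its PURE
  case "algebraic classes of codimension `s` are `(s,s)`" is consumed: the landed split `stub_algebraicKernelSplit` p99326 and
  the Hodge-type preservation of Hecke operators `heckeHodgeType`, p115730/p111880);
* `CupProductAlgebraic` — the route's support item stmt-HodgeConjecture-14350 (Voisin II Prop. 9.20), an `Assembly` hypothesis;
* **CoreHodgeClassesAlgebraic** (hypothesis `hCore`, verbatim below; rev 4's registered `stub_narrowCoreHodgeClassesAlgebraic` /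
  `stub_wideCoreHodgeClassesAlgebraic` are its halves by reach, rev 5's `stub_coreHodgeClassesAlgebraic` is it): every ℚ-BLOCK
  `ε` of the Hecke algebra `𝓗 = Algebra.adjoin ℂ (range T_g)` on `H²ⁿ(X(ℂ); ℂ)` (in `𝓗`, idempotent, central,
  rational-preserving, Hodge-type-preserving, primitive among such — the shape of `stub_rationalBlocks` p87916) which is
  IMPURE (some `ε β` not `(n,n)`) and UN-KILLED by the coefficient-conjugation sieve (some ℂ-block `z ≤ ε` carries a non-zero
  `(n,n)`-class under every `conjEnd σ z`) — a CORE — maps every rational `(n,n)`-class INTO `algebraicClasses X n`: the Hodge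
  conjecture for the classes `ε e` of Hecke cores. Implied by the route's target `MiddleDegreeStep`, by the sibling crux's
  registered bet `stub_coreVanishing` (stmt-HodgeConjecture-14300) granted the same two facts (companion file
  `…CoreHodgeClassesAlgebraicCalibration`), by nothing in print (BMM's range excludes the middle degree); refutable only by ¬HC.

Composition (all LANDED or theorems): split along `Alg` by Hodge–Riemann (`Theorems.algebraicOrEnveloped_of_algebraicKernelEnveloped`
p106212; Kähler package = the theorem `hardLefschetz_hodgeRiemann_holds`); envelope an `Alg`-orthogonal generator `e` by
`γ := Σ_{ε pure} γ_ε` over the pure ℚ-blocks (`stub_rationalBlocks` p87916, `stub_heckeGraphAlgebraic` p112869,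
`stub_corrAlgebra` p91059): `P_γ` preserves rational classes, is `(n,n)`-valued, and fixes `e` because every IMPURE
block kills `e` — a killed block by the sieve `stub_killedBarren` (p96373), a core because `ε e` is ALGEBRAIC
(`hCore`), rational, `(n,n)` and cup-orthogonal to `Alg` (`stub_corrActionAdjoint` p116389: `ε e ∪ x = e ∪ P_{γ'} x`,
`γ'` algebraic, `P_{γ'} x ∈ Alg`), hence zero (`Theorems.hodgeClass_eq_zero_of_cup_orthogonal`).
NOT here: any attack on `hCore` (HC-strength either way), any restatement of the crux, any new definition (the
hypothesis text is spelled out so that a planner can lift it into a `@[conjecture]` item / conditional bridge with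
this file as the kernel-checked glue); the narrow/wide split of the line card (a case distinction inside `hCore`).

References: BMM arXiv:1306.1515 Part 2 §1.8–1.9, Thm. 61; AMR arXiv:1507.01432 §8; Grothendieck, Topology 8 (1969) p. 300;
Voisin, Hodge Theory I Thm. 6.32, §7.1.2, II Prop. 9.20, Thm. 10.17; Fulton, Young Tableaux App. B §B.1; Shimura 1973 §3.4.
-/

noncomputable section
set_option linter.dupNamespace false -- `Summit.<P>.<Sub>.Theorems.…` repeats `HodgeConjecture` (single-conjunct summit)

namespace Summit.HodgeConjecture.HodgeConjecture.Theorems.EndoscopicMiddleDegreeAlgebraicOrEnvelopedOfCoreHodgeClassesAlgebraic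

open scoped BigOperators
open CategoryTheory MonoidalCategory CartesianMonoidalCategory
open Literature.AlgebraicGeometry.Motives (SchemeOver ComplexPoints IsSmoothProjective)
open Literature.AlgebraicGeometry.HodgeTheory
open Literature.AlgebraicGeometry.ShimuraVarieties
open Literature.AlgebraicTopology.SingularHomology
open Summit.HodgeConjecture.HodgeConjecture.Theses.EndoscopicMiddleDegree (AlgebraicOrEnveloped CupProductAlgebraic)
open Summit.HodgeConjecture.HodgeConjecture.Cruxes.MiddleThetaSpan.ConjugateDimensionSieve (IsPrimitiveCentralIdempotent)
open Summit.HodgeConjecture.HodgeConjecture.Cruxes.OrthogonalEnveloped.ImpureBarrenEnvelope (stub_rationalBlocks stub_corrAlgebra)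
open Summit.HodgeConjecture.HodgeConjecture.Cruxes.OrthogonalEnveloped.PuritySortedHeckeEnvelope (stub_killedBarren)
open Summit.HodgeConjecture.HodgeConjecture.Theorems.EndoscopicMiddleDegreeOrthogonalEnvelopedOfCoreVanishing
  (cupTriple_of_cupProductAlgebraic heckeHodgeType)

/-! ## Infrastructure (all from landed theorems; `CupProductAlgebraic` the only hypothesis) -/

/-- **The action of an algebraic self-correspondence of `X` preserves algebraic classes in the middle degree**: the tree's
`corrClassAction_mem_algebraicClasses_of_cupProduct` through `corrAction_eq_corrClassAction`. [cite: VoisinHodgeII2003, §9.2.4 Prop. 9.20] -/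
theorem corrAction_mem_algebraicClasses (hcup : CupProductAlgebraic) {μ : OrientationFamily}
    (hμ : μ.HasPoincareDuality) {m : ℕ} {X : SchemeOver ℂ} (hX : IsSmoothProjective (2 * (m + 1)) X)
    {γ : complexBetti (X ⊗ X) (2 * (2 * (m + 1)))} (hγ : γ ∈ algebraicClasses (X ⊗ X) (2 * (m + 1)))
    {c : complexBetti X (2 * (m + 1))} (hc : c ∈ algebraicClasses X (m + 1)) :
    corrAction μ hX hX (rfl : 2 * (m + 1) + 2 * (2 * (m + 1)) = 2 * (m + 1) + 2 * (2 * (m + 1))) γ c ∈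
      algebraicClasses X (m + 1) := by
  rw [corrAction_eq_corrClassAction μ hX hX _ (q := 2 * (m + 1)) (by ring)]
  exact corrClassAction_mem_algebraicClasses_of_cupProduct hX hX _ _ (hμ hX) (p := m + 1) (e := 2 * (m + 1))
    (q := m + 1) (k := 2 * (m + 1)) _ _
    (fun x y hx hy ↦ hcup (IsSmoothProjective.tensor_holds hX hX) (m + 1) (2 * (m + 1)) x y hx hy) hγ hc

/-- **The Hecke algebra is closed under cup-adjoints inside the actions of algebraic classes**: for every `a ∈ 𝓗` there
is an algebraic `γ'` on `X ⊗ X` with `a x ∪ y = x ∪ P_{γ'} y` — generators by the landed `stub_heckeGraphAlgebraic` (p112869)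
and `stub_corrActionAdjoint` (p116389: the cup-adjoint of `P_γ` is `P_{σ₊γ}`), scalars by the diagonal class of `stub_corrAlgebra`
(p91059), sums by `γ₁' + γ₂'`, products by composing actions. Replaces Hecke adjointness `T_g^† = T_{g⁻¹}`.
[cite: Shimura1973, §3.4 (3.4.5)] [cite: FultonYoungTableaux1997, Appendix B §B.1 (5)–(6)] -/
theorem heckeAlgebra_cupAdjoint (hcup : CupProductAlgebraic) {μ : OrientationFamily} (hμ : μ.HasPoincareDuality)
    {m : ℕ} {X : SchemeOver ℂ} (D : UnitaryBallQuotientDatum (2 * (m + 1)) X) (hm1 : 1 ≤ m) (hm2 : m ≤ 2)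
    {a : Module.End ℂ (complexBetti X (2 * (m + 1)))}
    (ha : a ∈ Algebra.adjoin ℂ (Set.range (D.heckeCorrespondenceAction (2 * (m + 1))))) :
    ∃ γ' ∈ algebraicClasses (X ⊗ X) (2 * (m + 1)),
      ∀ x y : complexBetti X (2 * (m + 1)),
        cupProduct (two_mul_add_two_mul (m + 1) (m + 1)) (a x) y =
          cupProduct (two_mul_add_two_mul (m + 1) (m + 1)) x
            (corrAction μ D.isSmoothProjective D.isSmoothProjective
              (rfl : 2 * (m + 1) + 2 * (2 * (m + 1)) = 2 * (m + 1) + 2 * (2 * (m + 1))) γ' y) := by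
  have hX : IsSmoothProjective (2 * (m + 1)) X := D.isSmoothProjective
  obtain ⟨⟨δ, hδ, hδid⟩, hcomp⟩ := stub_corrAlgebra μ hμ m X hX (cupTriple_of_cupProductAlgebraic hcup m X hX)
  induction ha using Algebra.adjoin_induction with
  | mem T hT =>
    obtain ⟨g, rfl⟩ := hT
    obtain ⟨γ, hγ, hP⟩ := Theorems.CoreSplittingLadder.stub_heckeGraphAlgebraic μ hμ m X D hm1 hm2 g
    obtain ⟨γ', hγ', h⟩ := Theorems.CoreSplittingLadder.stub_corrActionAdjoint μ hμ m X hX γ hγ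
    exact ⟨γ', hγ', fun x y ↦ by rw [← hP]; exact h x y⟩
  | algebraMap r =>
    refine ⟨r • δ, Submodule.smul_mem _ r hδ, fun x y ↦ ?_⟩
    rw [Module.algebraMap_end_apply, map_smul, LinearMap.smul_apply, map_smul, hδid, LinearMap.smul_apply,
      LinearMap.id_apply, map_smul]
  | add b b' _ _ ihb ihb' =>
    obtain ⟨γ₁, hγ₁, h₁⟩ := ihb
    obtain ⟨γ₂, hγ₂, h₂⟩ := ihb'
    refine ⟨γ₁ + γ₂, add_mem hγ₁ hγ₂, fun x y ↦ ?_⟩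
    rw [LinearMap.add_apply, map_add, LinearMap.add_apply, h₁, h₂, map_add, LinearMap.add_apply, map_add]
  | mul b b' _ _ ihb ihb' =>
    obtain ⟨γ₁, hγ₁, h₁⟩ := ihb
    obtain ⟨γ₂, hγ₂, h₂⟩ := ihb'
    obtain ⟨γ₃, hγ₃, h₃⟩ := hcomp γ₂ hγ₂ γ₁ hγ₁
    refine ⟨γ₃, hγ₃, fun x y ↦ ?_⟩
    rw [Module.End.mul_apply, h₁, h₂, h₃, LinearMap.comp_apply]

/-- **`Alg ∩ Alg^⊥` contains no non-zero rational Hodge class** (`dim X = 2n`, `n = m + 1`): a rational `(n,n)`-class `t`,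
algebraic AND cup-orthogonal to `algebraicClasses X n`, vanishes — `t ∪ t = 0` and `t ⊥ b ∪ d` for `b` rational Hodge `(m,m)`
(algebraic by `hlow`) and `d` a divisor class (`CupProductAlgebraic`), so the landed `Theorems.hodgeClass_eq_zero_of_cup_orthogonal`
(Lefschetz step + Hodge–Riemann; Kähler package = the theorem `hardLefschetz_hodgeRiemann_holds`) applies.
[cite: VoisinHodgeI2002, §6.3.2 Thm. 6.32 and §7.1.2] -/
theorem eq_zero_of_mem_algebraicClasses_of_cup_orthogonal (hcup : CupProductAlgebraic) {m : ℕ} {X : SchemeOver ℂ}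
    (hX : IsSmoothProjective (2 * (m + 1)) X)
    (hlow : ∀ a : complexBetti X (2 * m), IsRationalClass a →
      IsOfHodgeType (2 * (m + 1)) X (2 * m) m m a → a ∈ algebraicClasses X m)
    {t : complexBetti X (2 * (m + 1))} (htQ : IsRationalClass t)
    (htT : IsOfHodgeType (2 * (m + 1)) X (2 * (m + 1)) (m + 1) (m + 1) t)
    (halg : t ∈ algebraicClasses X (m + 1))
    (horth : ∀ x ∈ algebraicClasses X (m + 1), cupProduct (two_mul_add_two_mul (m + 1) (m + 1)) t x = 0) :
    t = 0 := by
  obtain ⟨A, htA⟩ := htT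
  exact Theorems.hodgeClass_eq_zero_of_cup_orthogonal hardLefschetz_hodgeRiemann_holds hX A htQ htA
    (fun b hbQ hbT d hd ↦ horth _ (hcup hX m 1 b d (hlow b hbQ hbT) hd)) (horth t halg)

/-! ## Impure blocks kill `Alg`-orthogonal rational Hodge classes, granted HC on cores -/
/-- **IMPURE BLOCKS KILL `Alg`-ORTHOGONAL RATIONAL `(n,n)`-CLASSES**, granted that the Hecke algebra preserves Hodge types
(`hH`: from Grothendieck's coniveau remark by `heckeHodgeType`, or from its pure case), `CupProductAlgebraic` and HC on the core
`ε` (`hCore`, the bet): a KILLED block by the landed sieve `stub_killedBarren` (p96373); a CORE maps `e` to an ALGEBRAIC class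
`ε e`, rational, `(n,n)`, cup-orthogonal to `Alg` (`ε e ∪ x = e ∪ P_{γ'} x`, `heckeAlgebra_cupAdjoint`, with `P_{γ'} x`
algebraic, `corrAction_mem_algebraicClasses`) — hence zero. [cite: BergeronMillsonMoeglin2016Balls, Part 2 §1.9 and Thm. 61] -/
theorem impureBlock_apply_eq_zero (hcup : CupProductAlgebraic) {μ : OrientationFamily} (hμ : μ.HasPoincareDuality)
    {m : ℕ} {X : SchemeOver ℂ} (D : UnitaryBallQuotientDatum (2 * (m + 1)) X) (hm1 : 1 ≤ m) (hm2 : m ≤ 2)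
    (hH : ∀ a ∈ Algebra.adjoin ℂ (Set.range (D.heckeCorrespondenceAction (2 * (m + 1)))),
      ∀ (p q : ℕ) (x : complexBetti X (2 * (m + 1))), IsOfHodgeType (2 * (m + 1)) X (2 * (m + 1)) p q x →
        IsOfHodgeType (2 * (m + 1)) X (2 * (m + 1)) p q (a x))
    (hlow : ∀ a : complexBetti X (2 * m), IsRationalClass a →
      IsOfHodgeType (2 * (m + 1)) X (2 * m) m m a → a ∈ algebraicClasses X m)
    {ε : Module.End ℂ (complexBetti X (2 * (m + 1)))}
    (h1 : ε ∈ Algebra.adjoin ℂ (Set.range (D.heckeCorrespondenceAction (2 * (m + 1)))))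
    (h2 : ε * ε = ε)
    (h3 : ∀ T ∈ Algebra.adjoin ℂ (Set.range (D.heckeCorrespondenceAction (2 * (m + 1)))), T * ε = ε * T)
    (h4 : ∀ β, IsRationalClass β → IsRationalClass (ε β))
    (hCore : (∀ (p q : ℕ) (x : complexBetti X (2 * (m + 1))), IsOfHodgeType (2 * (m + 1)) X (2 * (m + 1)) p q x →
          IsOfHodgeType (2 * (m + 1)) X (2 * (m + 1)) p q (ε x)) →
        (∃ z : Module.End ℂ (complexBetti X (2 * (m + 1))),
          IsPrimitiveCentralIdempotent
              (Algebra.adjoin ℂ (Set.range (D.heckeCorrespondenceAction (2 * (m + 1))))) z ∧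
            z * ε = z ∧
              ∀ σ : ℂ ≃+* ℂ, ∃ c : complexBetti X (2 * (m + 1)),
                IsOfHodgeType (2 * (m + 1)) X (2 * (m + 1)) (m + 1) (m + 1) (conjEnd σ z c) ∧
                  conjEnd σ z c ≠ 0) →
        ∀ e : complexBetti X (2 * (m + 1)), IsRationalClass e →
          IsOfHodgeType (2 * (m + 1)) X (2 * (m + 1)) (m + 1) (m + 1) e →
          ε e ∈ algebraicClasses X (m + 1))
    {e : complexBetti X (2 * (m + 1))} (he : IsRationalClass e)
    (heH : IsOfHodgeType (2 * (m + 1)) X (2 * (m + 1)) (m + 1) (m + 1) e)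
    (horth : ∀ x ∈ algebraicClasses X (m + 1), cupProduct (two_mul_add_two_mul (m + 1) (m + 1)) e x = 0) :
    ε e = 0 := by
  classical
  have hX : IsSmoothProjective (2 * (m + 1)) X := D.isSmoothProjective
  -- the Hecke algebra preserves the type `(n,n)` (hypothesis `hH` of the sieve)
  have hHodge : ∀ a ∈ Algebra.adjoin ℂ (Set.range (D.heckeCorrespondenceAction (2 * (m + 1)))),
      ∀ c : complexBetti X (2 * (m + 1)),
        IsOfHodgeType (2 * (m + 1)) X (2 * (m + 1)) (m + 1) (m + 1) c →
          IsOfHodgeType (2 * (m + 1)) X (2 * (m + 1)) (m + 1) (m + 1) (a c) :=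
    fun a ha c hc ↦ hH a ha _ _ c hc
  by_cases hK : ∀ z : Module.End ℂ (complexBetti X (2 * (m + 1))),
      IsPrimitiveCentralIdempotent (Algebra.adjoin ℂ (Set.range (D.heckeCorrespondenceAction (2 * (m + 1))))) z →
        z * ε = z →
          ∃ σ : ℂ ≃+* ℂ, ∀ c : complexBetti X (2 * (m + 1)),
            IsOfHodgeType (2 * (m + 1)) X (2 * (m + 1)) (m + 1) (m + 1) (conjEnd σ z c) → conjEnd σ z c = 0
  · -- (K) a KILLED block: barren by the sieve (landed)
    exact stub_killedBarren m X D hm1 hm2 hHodge ε h1 h2 h3 hK e he heH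
  · -- (C) a CORE
    have hcore : ∃ z : Module.End ℂ (complexBetti X (2 * (m + 1))),
        IsPrimitiveCentralIdempotent (Algebra.adjoin ℂ (Set.range (D.heckeCorrespondenceAction (2 * (m + 1))))) z ∧
          z * ε = z ∧
            ∀ σ : ℂ ≃+* ℂ, ∃ c : complexBetti X (2 * (m + 1)),
              IsOfHodgeType (2 * (m + 1)) X (2 * (m + 1)) (m + 1) (m + 1) (conjEnd σ z c) ∧ conjEnd σ z c ≠ 0 := by
      push Not at hK
      exact hK
    -- `ε` preserves every Hodge type
    have hεH : ∀ (p q : ℕ) (x : complexBetti X (2 * (m + 1))),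
        IsOfHodgeType (2 * (m + 1)) X (2 * (m + 1)) p q x →
          IsOfHodgeType (2 * (m + 1)) X (2 * (m + 1)) p q (ε x) :=
      hH ε h1
    -- the core maps `e` to an ALGEBRAIC class (the bet)
    have halg : ε e ∈ algebraicClasses X (m + 1) := hCore hεH hcore e he heH
    -- … which is cup-orthogonal to `Alg`: `ε e ∪ x = e ∪ P_{γ'} x` with `P_{γ'} x` algebraic
    obtain ⟨γ', hγ', hadj⟩ := heckeAlgebra_cupAdjoint hcup hμ D hm1 hm2 h1
    have horth' : ∀ x ∈ algebraicClasses X (m + 1),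
        cupProduct (two_mul_add_two_mul (m + 1) (m + 1)) (ε e) x = 0 := fun x hx ↦ by
      rw [hadj]
      exact horth _ (corrAction_mem_algebraicClasses hcup hμ hX hγ' hx)
    -- … hence zero (`Alg ∩ Alg^⊥ ∩ Hdg_ℚ = 0`)
    exact eq_zero_of_mem_algebraicClasses_of_cup_orthogonal hcup hX hlow (h4 e he) (hεH _ _ e heH) halg horth'

/-! ## The residual and the crux, granted the two facts and HC on cores -/
/-- **THE RESIDUAL of the crux, granted Hodge-type preservation by the Hecke algebras (`hH`), `CupProductAlgebraic` and
HC on Hecke cores**: an `Alg`-orthogonal rational Hodge `(n,n)`-class `e` is enveloped by `γ := Σ_{ε pure} γ_ε` over the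
pure ℚ-blocks of the Hecke algebra (`stub_rationalBlocks` p87916, `stub_heckeGraphAlgebraic` p112869, `stub_corrAlgebra`
p91059): `P_γ` preserves rational classes, is `(n,n)`-valued, and fixes `e` because `Σ_ε ε = 1` and every impure block
kills `e` (`impureBlock_apply_eq_zero`). [cite: BergeronMillsonMoeglin2016Balls, Part 2 §1.9 and Thm. 61] -/
theorem algebraicKernelEnveloped_of_coreHodgeClassesAlgebraic
    (hH : ∀ (m : ℕ) (X : SchemeOver ℂ) (D : UnitaryBallQuotientDatum (2 * (m + 1)) X), 1 ≤ m → m ≤ 2 →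
      ∀ a ∈ Algebra.adjoin ℂ (Set.range (D.heckeCorrespondenceAction (2 * (m + 1)))),
        ∀ (p q : ℕ) (x : complexBetti X (2 * (m + 1))), IsOfHodgeType (2 * (m + 1)) X (2 * (m + 1)) p q x →
          IsOfHodgeType (2 * (m + 1)) X (2 * (m + 1)) p q (a x))
    (hcup : CupProductAlgebraic)
    (hCore : ∀ (m : ℕ) (X : SchemeOver ℂ) (D : UnitaryBallQuotientDatum (2 * (m + 1)) X), 1 ≤ m → m ≤ 2 →
      (∀ a : complexBetti X (2 * m), IsRationalClass a →
        IsOfHodgeType (2 * (m + 1)) X (2 * m) m m a → a ∈ algebraicClasses X m) →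
      ∀ ε : Module.End ℂ (complexBetti X (2 * (m + 1))),
        ε ∈ Algebra.adjoin ℂ (Set.range (D.heckeCorrespondenceAction (2 * (m + 1)))) →
        ε * ε = ε →
        (∀ T ∈ Algebra.adjoin ℂ (Set.range (D.heckeCorrespondenceAction (2 * (m + 1)))),
          T * ε = ε * T) →
        (∀ β, IsRationalClass β → IsRationalClass (ε β)) →
        (∀ (p q : ℕ) (x : complexBetti X (2 * (m + 1))), IsOfHodgeType (2 * (m + 1)) X (2 * (m + 1)) p q x →
          IsOfHodgeType (2 * (m + 1)) X (2 * (m + 1)) p q (ε x)) →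
        (∀ f ∈ Algebra.adjoin ℂ (Set.range (D.heckeCorrespondenceAction (2 * (m + 1)))),
          f * f = f →
          (∀ T ∈ Algebra.adjoin ℂ (Set.range (D.heckeCorrespondenceAction (2 * (m + 1)))),
            T * f = f * T) →
          (∀ β, IsRationalClass β → IsRationalClass (f β)) → f * ε = 0 ∨ f * ε = ε) →
        (∃ β, ¬ IsOfHodgeType (2 * (m + 1)) X (2 * (m + 1)) (m + 1) (m + 1) (ε β)) →
        (∃ z : Module.End ℂ (complexBetti X (2 * (m + 1))),
          IsPrimitiveCentralIdempotent
              (Algebra.adjoin ℂ (Set.range (D.heckeCorrespondenceAction (2 * (m + 1))))) z ∧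
            z * ε = z ∧
              ∀ σ : ℂ ≃+* ℂ, ∃ c : complexBetti X (2 * (m + 1)),
                IsOfHodgeType (2 * (m + 1)) X (2 * (m + 1)) (m + 1) (m + 1) (conjEnd σ z c) ∧
                  conjEnd σ z c ≠ 0) →
        ∀ e : complexBetti X (2 * (m + 1)), IsRationalClass e →
          IsOfHodgeType (2 * (m + 1)) X (2 * (m + 1)) (m + 1) (m + 1) e →
          ε e ∈ algebraicClasses X (m + 1)) :
    ∀ (μ : OrientationFamily), μ.HasPoincareDuality →
      ∀ (m : ℕ) (X : SchemeOver ℂ) (D : UnitaryBallQuotientDatum (2 * (m + 1)) X), 1 ≤ m → m ≤ 2 →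
      (∀ a : complexBetti X (2 * m), IsRationalClass a →
        IsOfHodgeType (2 * (m + 1)) X (2 * m) m m a → a ∈ algebraicClasses X m) →
      ∀ e : complexBetti X (2 * (m + 1)), IsRationalClass e →
        IsOfHodgeType (2 * (m + 1)) X (2 * (m + 1)) (m + 1) (m + 1) e →
        (∀ x ∈ algebraicClasses X (m + 1),
          cupProduct (two_mul_add_two_mul (m + 1) (m + 1)) e x = 0) →
        ∃ γ ∈ algebraicClasses (X ⊗ X) (2 * (m + 1)),
          (∀ β, IsRationalClass β → IsRationalClass
            (complexGysin μ
              (IsSmoothProjective.tensor_holds D.isSmoothProjective D.isSmoothProjective)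
              D.isSmoothProjective (fst X X)
              (show 2 * (m + 1) + 2 * (2 * (m + 1)) + 2 * (2 * (m + 1)) =
                2 * (m + 1) + 2 * (2 * (m + 1) + 2 * (m + 1)) by ring)
              (cupProduct (rfl : 2 * (m + 1) + 2 * (2 * (m + 1)) = 2 * (m + 1) + 2 * (2 * (m + 1)))
                (complexBetti.map (snd X X) (2 * (m + 1)) β) γ))) ∧
          (∀ β, IsOfHodgeType (2 * (m + 1)) X (2 * (m + 1)) (m + 1) (m + 1)
            (complexGysin μ
              (IsSmoothProjective.tensor_holds D.isSmoothProjective D.isSmoothProjective)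
              D.isSmoothProjective (fst X X)
              (show 2 * (m + 1) + 2 * (2 * (m + 1)) + 2 * (2 * (m + 1)) =
                2 * (m + 1) + 2 * (2 * (m + 1) + 2 * (m + 1)) by ring)
              (cupProduct (rfl : 2 * (m + 1) + 2 * (2 * (m + 1)) = 2 * (m + 1) + 2 * (2 * (m + 1)))
                (complexBetti.map (snd X X) (2 * (m + 1)) β) γ))) ∧
          (complexGysin μ
              (IsSmoothProjective.tensor_holds D.isSmoothProjective D.isSmoothProjective)
              D.isSmoothProjective (fst X X)
              (show 2 * (m + 1) + 2 * (2 * (m + 1)) + 2 * (2 * (m + 1)) =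
                2 * (m + 1) + 2 * (2 * (m + 1) + 2 * (m + 1)) by ring)
              (cupProduct (rfl : 2 * (m + 1) + 2 * (2 * (m + 1)) = 2 * (m + 1) + 2 * (2 * (m + 1)))
                (complexBetti.map (snd X X) (2 * (m + 1)) e) γ)) = e := by
  intro μ hμ m X D hm1 hm2 hlow e he heH horth
  classical
  have hX : IsSmoothProjective (2 * (m + 1)) X := D.isSmoothProjective
  -- the ℚ-blocks of the Hecke algebra (landed)
  obtain ⟨s, hblk, -, hsum⟩ := stub_rationalBlocks m X D hm1 hm2
  -- the subalgebra of actions of algebraic self-correspondences contains the Hecke algebra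
  obtain ⟨⟨δ, hδ, hδid⟩, hcomp⟩ := stub_corrAlgebra μ hμ m X hX (cupTriple_of_cupProductAlgebraic hcup m X hX)
  let S : Subalgebra ℂ (Module.End ℂ (complexBetti X (2 * (m + 1)))) :=
    { carrier := {T | ∃ γ ∈ algebraicClasses (X ⊗ X) (2 * (m + 1)),
        corrAction μ hX hX (rfl : 2 * (m + 1) + 2 * (2 * (m + 1)) = 2 * (m + 1) + 2 * (2 * (m + 1))) γ = T}
      mul_mem' := by
        rintro _ _ ⟨γ, hγ, rfl⟩ ⟨γ', hγ', rfl⟩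
        exact hcomp γ hγ γ' hγ'
      one_mem' := ⟨δ, hδ, hδid⟩
      add_mem' := by
        rintro _ _ ⟨γ, hγ, rfl⟩ ⟨γ', hγ', rfl⟩
        exact ⟨γ + γ', add_mem hγ hγ', map_add _ _ _⟩
      zero_mem' := ⟨0, zero_mem _, map_zero _⟩
      algebraMap_mem' := fun c ↦ ⟨c • δ, Submodule.smul_mem _ c hδ, by
        rw [map_smul, hδid, Algebra.algebraMap_eq_smul_one]; rfl⟩ }
  have hle : Algebra.adjoin ℂ (Set.range (D.heckeCorrespondenceAction (2 * (m + 1)))) ≤ S := by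
    refine Algebra.adjoin_le ?_
    rintro _ ⟨g, rfl⟩
    exact Theorems.CoreSplittingLadder.stub_heckeGraphAlgebraic μ hμ m X D hm1 hm2 g
  -- each block is the action of an algebraic class
  have hεS : ∀ ε ∈ s, ∃ γ ∈ algebraicClasses (X ⊗ X) (2 * (m + 1)),
      corrAction μ hX hX (rfl : 2 * (m + 1) + 2 * (2 * (m + 1)) = 2 * (m + 1) + 2 * (2 * (m + 1))) γ = ε :=
    fun ε hε ↦ hle (hblk ε hε).1
  choose! γf hγf hPγ using hεS
  -- the pure blocks and the envelope
  let pure : Module.End ℂ (complexBetti X (2 * (m + 1))) → Prop :=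
    fun ε ↦ ∀ β, IsOfHodgeType (2 * (m + 1)) X (2 * (m + 1)) (m + 1) (m + 1) (ε β)
  have hP : corrAction μ hX hX (rfl : 2 * (m + 1) + 2 * (2 * (m + 1)) = 2 * (m + 1) + 2 * (2 * (m + 1)))
      (∑ ε ∈ s.filter pure, γf ε) = ∑ ε ∈ s.filter pure, ε := by
    rw [map_sum]
    exact Finset.sum_congr rfl fun ε hε ↦ hPγ ε (Finset.mem_filter.1 hε).1
  have key : ∀ β : complexBetti X (2 * (m + 1)),
      complexGysin μ (IsSmoothProjective.tensor_holds D.isSmoothProjective D.isSmoothProjective)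
        D.isSmoothProjective (fst X X)
        (show 2 * (m + 1) + 2 * (2 * (m + 1)) + 2 * (2 * (m + 1)) =
          2 * (m + 1) + 2 * (2 * (m + 1) + 2 * (m + 1)) by ring)
        (cupProduct (rfl : 2 * (m + 1) + 2 * (2 * (m + 1)) = 2 * (m + 1) + 2 * (2 * (m + 1)))
          (complexBetti.map (snd X X) (2 * (m + 1)) β) (∑ ε ∈ s.filter pure, γf ε)) =
        ∑ ε ∈ s.filter pure, ε β := fun β ↦ by
    change corrAction μ hX hX (rfl : 2 * (m + 1) + 2 * (2 * (m + 1)) = 2 * (m + 1) + 2 * (2 * (m + 1)))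
      (∑ ε ∈ s.filter pure, γf ε) β = _
    rw [hP, LinearMap.sum_apply]
  obtain ⟨A, -⟩ := id heH
  refine ⟨∑ ε ∈ s.filter pure, γf ε, Submodule.sum_mem _ fun ε hε ↦ hγf ε (Finset.mem_filter.1 hε).1,
    fun β hβ ↦ ?_, fun β ↦ ?_, ?_⟩
  · -- rational classes are preserved: each ℚ-block preserves them
    rw [key]
    exact Finset.sum_induction _ (fun x ↦ IsRationalClass x) (fun a b ha hb ↦ ha.add hb)
      IsRationalClass.zero (fun ε hε ↦ (hblk ε (Finset.mem_filter.1 hε).1).2.2.2.1 β hβ)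
  · -- the image is purely `(n,n)`: a sum of `(n,n)`-classes (pure blocks, by definition)
    rw [key]
    exact IsOfHodgeType.sum hX A _ _ fun ε hε ↦ (Finset.mem_filter.1 hε).2 β
  · -- `e` is fixed: `e = Σ_ε ε e`, and every impure block — killed or core — kills `e`
    rw [key]
    have he_sum : e = ∑ ε ∈ s, ε e := by
      conv_lhs => rw [show e = (∑ ε ∈ s, ε) e by rw [hsum]; rfl]
      rw [LinearMap.sum_apply]
    have hzero : ∑ ε ∈ s.filter (fun ε ↦ ¬ pure ε), ε e = 0 := by
      refine Finset.sum_eq_zero fun ε hε ↦ ?_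
      obtain ⟨hεs, hnp⟩ := Finset.mem_filter.1 hε
      obtain ⟨h1, h2, h3, h4, h5⟩ := hblk ε hεs
      exact impureBlock_apply_eq_zero hcup hμ D hm1 hm2 (hH m X D hm1 hm2) hlow h1 h2 h3 h4
        (fun hεH hcore ↦ hCore m X D hm1 hm2 hlow ε h1 h2 h3 h4 hεH h5 (not_forall.1 hnp) hcore) he heH horth
    conv_rhs => rw [he_sum, ← Finset.sum_filter_add_sum_filter_not s pure]
    rw [hzero, add_zero]

/-- **`AlgebraicOrEnveloped` GRANTED Grothendieck's coniveau remark, `CupProductAlgebraic` and the Hodge conjecture on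
Hecke cores** — the registered skeleton of line `core-splitting-ladder` (`AlgebraicOrEnveloped_of`, rev 5) with its three
stubs as hypotheses: the landed glue `Theorems.algebraicOrEnveloped_of_algebraicKernelEnveloped` (p106212; Kähler package =
the theorem `hardLefschetz_hodgeRiemann_holds`) fed with `algebraicKernelEnveloped_of_coreHodgeClassesAlgebraic`.
[cite: BergeronMillsonMoeglin2016Balls, Part 2 §1.9 and Thm. 61] [cite: VoisinHodgeI2002, Thm. 6.32 and §7.1.2] -/
theorem algebraicOrEnveloped_of_coreHodgeClassesAlgebraic :
    Grothendieck1969_supportedClasses_le_hodgeConiveau → CupProductAlgebraic →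
    (∀ (m : ℕ) (X : SchemeOver ℂ) (D : UnitaryBallQuotientDatum (2 * (m + 1)) X), 1 ≤ m → m ≤ 2 →
      (∀ a : complexBetti X (2 * m), IsRationalClass a →
        IsOfHodgeType (2 * (m + 1)) X (2 * m) m m a → a ∈ algebraicClasses X m) →
      ∀ ε : Module.End ℂ (complexBetti X (2 * (m + 1))),
        ε ∈ Algebra.adjoin ℂ (Set.range (D.heckeCorrespondenceAction (2 * (m + 1)))) →
        ε * ε = ε →
        (∀ T ∈ Algebra.adjoin ℂ (Set.range (D.heckeCorrespondenceAction (2 * (m + 1)))),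
          T * ε = ε * T) →
        (∀ β, IsRationalClass β → IsRationalClass (ε β)) →
        (∀ (p q : ℕ) (x : complexBetti X (2 * (m + 1))), IsOfHodgeType (2 * (m + 1)) X (2 * (m + 1)) p q x →
          IsOfHodgeType (2 * (m + 1)) X (2 * (m + 1)) p q (ε x)) →
        (∀ f ∈ Algebra.adjoin ℂ (Set.range (D.heckeCorrespondenceAction (2 * (m + 1)))),
          f * f = f →
          (∀ T ∈ Algebra.adjoin ℂ (Set.range (D.heckeCorrespondenceAction (2 * (m + 1)))),
            T * f = f * T) →
          (∀ β, IsRationalClass β → IsRationalClass (f β)) → f * ε = 0 ∨ f * ε = ε) →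
        (∃ β, ¬ IsOfHodgeType (2 * (m + 1)) X (2 * (m + 1)) (m + 1) (m + 1) (ε β)) →
        (∃ z : Module.End ℂ (complexBetti X (2 * (m + 1))),
          IsPrimitiveCentralIdempotent
              (Algebra.adjoin ℂ (Set.range (D.heckeCorrespondenceAction (2 * (m + 1))))) z ∧
            z * ε = z ∧
              ∀ σ : ℂ ≃+* ℂ, ∃ c : complexBetti X (2 * (m + 1)),
                IsOfHodgeType (2 * (m + 1)) X (2 * (m + 1)) (m + 1) (m + 1) (conjEnd σ z c) ∧
                  conjEnd σ z c ≠ 0) →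
        ∀ e : complexBetti X (2 * (m + 1)), IsRationalClass e →
          IsOfHodgeType (2 * (m + 1)) X (2 * (m + 1)) (m + 1) (m + 1) e →
          ε e ∈ algebraicClasses X (m + 1)) →
    AlgebraicOrEnveloped :=
  fun hG hcup hCore ↦
    -- Hodge types are preserved by the Hecke algebras (`heckeHodgeType` p115730, at the complex orientation family)
    have hμ : OrientationFamily.HasPoincareDuality
        (fun _ _ h ↦ Classical.choice (Literature.AlgebraicGeometry.Motives.ComplexPoints.isOrientableOver ℂ h)) :=
      OrientationFamily.hasPoincareDuality_of
        (fun ν _ _ h ↦ Literature.AlgebraicTopology.SingularHomology.poincare_duality ν h) _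
    Theorems.algebraicOrEnveloped_of_algebraicKernelEnveloped (fun _ _ ↦ hardLefschetz_hodgeRiemann_holds) hG hcup
      (algebraicKernelEnveloped_of_coreHodgeClassesAlgebraic
        (fun _ _ D hm1 hm2 _ ha _ _ x hx ↦ heckeHodgeType hG hμ D hm1 hm2 ha x hx) hcup hCore)

end Summit.HodgeConjecture.HodgeConjecture.Theorems.EndoscopicMiddleDegreeAlgebraicOrEnvelopedOfCoreHodgeClassesAlgebraic

end
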